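import Summits.ABC.ABC.Theses.RibetTakahashiSplit
import Literature.NumberTheory.EllipticCurves.SzpiroOfAbcProofs
import Literature.NumberTheory.EllipticCurves.SzpiroLocalDataProofs

/-!
# Stub `stub_localData` of line `Sketch` (idea `thin-strong-hall-transfer`, crux stmt-ABC-17927)

Helper (`--supports stmt-ABC-17927`) for the registered stub `stub_localData` of the line `Sketch` for
the crux `Summit.ABC.ABC.Theses.RibetTakahashiSplit.ThinWeightedSzpiro` (thin-class weighted Szpiro).

The line reduces the crux to an elliptic-curve-free statement about `(x, y) ↦ x³ − y²` via
`x = c₄(W₀)`, `y = c₆(W₀)`, `z = x³ − y² = 1728 · Δ(W₀)` (Mathlib `WeierstrassCurve.c_relation`).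
This file reads the LOCAL DATA of a global minimal model `W₀/ℤ` of `E/ℚ`, semistable away from `2`,
on the triple `(x, y, z)`:

* `z ≠ 0`: `z = 1728 Δ` and `Δ ≠ 0` (`WeierstrassCurve.Δ_ne_zero_of_isElliptic_baseChange_int`);
* `1728 ∣ z`: the witness is `Δ`;
* primitivity at `2`: minimality at the place above `2` excludes `2⁸ ∣ c₄ ∧ 2¹¹ ∣ c₆`
  (`WeierstrassCurve.not_pow_dvd_c₄_c₆_of_isMinimalAt_two`, Silverman AEC Ex. 8.21);
* primitivity at `3`: minimality at the place above `3` excludes `3⁵ ∣ c₄ ∧ 3⁹ ∣ c₆`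
  (`WeierstrassCurve.not_pow_dvd_c₄_c₆_of_isMinimalAt_three`); and `3⁴ ∣ c₄`, `3⁹ ∣ c₆`,
  `3¹² · 1728 ∣ c₄³ − c₆²` already force `3⁵ ∣ c₄` (`3¹⁵ ∣ z` and `3¹⁸ ∣ c₆²` give `3¹⁵ ∣ c₄³`);
* no prime `p ≥ 5` divides both `c₄` and `z`: such a `p` divides `Δ` (`p ∤ 1728 = 2⁶ 3³`), so `E`
  has additive reduction at `p` and `p² ∣ N_E`
  (`WeierstrassCurve.sq_dvd_conductorNorm_of_dvd_Δ_of_dvd_c₄`, Silverman AEC VIII.11 and Ex. 8.21),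
  contradicting semistability away from `2`.

All ingredients are PROVED tree lemmas (`Literature.NumberTheory.EllipticCurves.SzpiroOfAbcProofs`,
`…SzpiroMinimalityProofs`, `…SzpiroLocalDataProofs`, `…SzpiroAbcCoreProofs`); the calling conventions
follow `Literature.NumberTheory.EllipticCurves.szpiro_of_abcLe_holds`.

Sources: J. H. Silverman, *The Arithmetic of Elliptic Curves*, GTM 106, 2nd ed. 2009, VII.1, VII.5.1,
VIII.11, Exercise 8.21 [SilvermanAEC2009].
-/

-- `Summit.<Summit>.<Problem>` is the mandated summit-side namespace (CONVENTIONS §2); for the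
-- single-conjunct summit `ABC` the two coincide, so the duplicate `ABC.ABC` is deliberate.
set_option linter.dupNamespace false

namespace Summit.ABC.ABC.Theorems.ThinWeightedSzpiro

open IsDedekindDomain

/-- The `3`-adic lift: `3⁹ ∣ y` and `3¹² · 1728 ∣ x³ − y²` force `3⁵ ∣ x`
(`3¹² · 1728 = 2⁶ · 3¹⁵`, so `3¹⁵ ∣ x³ = (x³ − y²) + y²`, and `(3⁵)³ ∣ x³ ⟹ 3⁵ ∣ x` in `ℤ`).
`[folklore]` -/
private theorem three_pow_five_dvd_of_dvd_sub_sq {x y : ℤ} (h9 : (3 : ℤ) ^ 9 ∣ y)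
    (h12 : (3 : ℤ) ^ 12 * 1728 ∣ x ^ 3 - y ^ 2) : (3 : ℤ) ^ 5 ∣ x := by
  have h18 : (3 : ℤ) ^ 18 ∣ y ^ 2 := by
    obtain ⟨k, hk⟩ := h9
    exact ⟨k ^ 2, by rw [hk]; ring⟩
  have h15 : (3 : ℤ) ^ 15 ∣ x ^ 3 - y ^ 2 + y ^ 2 :=
    dvd_add (dvd_trans ⟨64, by norm_num⟩ h12) (dvd_trans ⟨27, by norm_num⟩ h18)
  rw [sub_add_cancel] at h15
  have h53 : ((3 : ℤ) ^ 5) ^ 3 ∣ x ^ 3 := by rwa [← pow_mul]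
  exact (Int.pow_dvd_pow_iff (by norm_num)).mp h53

/-- A prime `p ≥ 5` dividing `1728 d` divides `d` (`1728 = 2⁶ · 3³`; integer version of
`Literature.NumberTheory.EllipticCurves.SzpiroOfAbc.dvd_of_five_le_of_dvd_1728_mul`). `[folklore]` -/
private theorem natCast_dvd_of_dvd_mul_of_five_le {p : ℕ} (hp : p.Prime) (h5 : 5 ≤ p) {d : ℤ}
    (hd : d ≠ 0) (h : (p : ℤ) ∣ 1728 * d) : (p : ℤ) ∣ d := by
  refine Int.natCast_dvd.mpr
    (Literature.NumberTheory.EllipticCurves.SzpiroOfAbc.dvd_of_five_le_of_dvd_1728_mul hp h5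
      (Int.natAbs_ne_zero.mpr hd) ?_)
  have h' := Int.natCast_dvd.mp h
  rw [Int.natAbs_mul] at h'
  exact h'

/-- **Stub `stub_localData`** (line `Sketch`, crux `ThinWeightedSzpiro`): the local data of a global
minimal model `W₀/ℤ` of an elliptic curve over `ℚ`, minimal at every finite place and with
`p² ∤ N_E` for every odd prime `p`, read on `(x, y, z) = (c₄, c₆, c₄³ − c₆² = 1728 Δ)`:
`z ≠ 0`, `1728 ∣ z`, primitivity at `2` and `3` (from the minimality constraints
`¬ (2⁸ ∣ c₄ ∧ 2¹¹ ∣ c₆)`, `¬ (3⁵ ∣ c₄ ∧ 3⁹ ∣ c₆)`, Silverman AEC Ex. 8.21), and no prime `p ≥ 5`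
divides both `c₄` and `z` (additive reduction at `p` would give `p² ∣ N_E`, AEC VIII.11).
`[folklore]` -/
theorem stub_localData : ∀ W₀ : WeierstrassCurve ℤ, (W₀.baseChange ℚ).IsElliptic →
    (∀ v : IsDedekindDomain.HeightOneSpectrum ℤ, (W₀.baseChange ℚ).IsMinimalAt v) →
    (∀ p : ℕ, p.Prime → p ≠ 2 → ¬ p ^ 2 ∣ (W₀.baseChange ℚ).conductorNorm ℤ) →
    W₀.c₄ ^ 3 - W₀.c₆ ^ 2 ≠ 0 ∧ (1728 : ℤ) ∣ W₀.c₄ ^ 3 - W₀.c₆ ^ 2 ∧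
    (¬ ((2 : ℤ) ^ 8 ∣ W₀.c₄ ∧ (2 : ℤ) ^ 11 ∣ W₀.c₆ ∧ (2 : ℤ) ^ 12 * 1728 ∣ W₀.c₄ ^ 3 - W₀.c₆ ^ 2) ∧
      ¬ ((3 : ℤ) ^ 4 ∣ W₀.c₄ ∧ (3 : ℤ) ^ 9 ∣ W₀.c₆ ∧ (3 : ℤ) ^ 12 * 1728 ∣ W₀.c₄ ^ 3 - W₀.c₆ ^ 2)) ∧
    (∀ p : ℕ, p.Prime → 5 ≤ p → (p : ℤ) ∣ W₀.c₄ → ¬ (p : ℤ) ∣ W₀.c₄ ^ 3 - W₀.c₆ ^ 2) := by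
  intro W₀ hE hmin hss
  have hΔ0 : W₀.Δ ≠ 0 := @WeierstrassCurve.Δ_ne_zero_of_isElliptic_baseChange_int W₀ hE
  -- `z = c₄³ − c₆² = 1728 Δ`
  have hz : W₀.c₄ ^ 3 - W₀.c₆ ^ 2 = 1728 * W₀.Δ := W₀.c_relation.symm
  refine ⟨?_, ⟨W₀.Δ, hz⟩, ⟨?_, ?_⟩, ?_⟩
  · -- `z ≠ 0`
    rw [hz]
    exact mul_ne_zero (by norm_num) hΔ0
  · -- primitivity at `2`: minimality at the place of `ℤ` above `2`
    rintro ⟨h8, h11, -⟩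
    exact WeierstrassCurve.not_pow_dvd_c₄_c₆_of_isMinimalAt_two _ W₀ hΔ0 (hmin _)
      (WeierstrassCurve.natGenerator_primesEquiv_symm 2 Nat.prime_two) ⟨h8, h11⟩
  · -- primitivity at `3`: minimality at the place of `ℤ` above `3`, after the `3`-adic lift
    rintro ⟨-, h9, h12⟩
    exact WeierstrassCurve.not_pow_dvd_c₄_c₆_of_isMinimalAt_three _ W₀ hΔ0 (hmin _)
      (WeierstrassCurve.natGenerator_primesEquiv_symm 3 Nat.prime_three)
      ⟨three_pow_five_dvd_of_dvd_sub_sq h9 h12, h9⟩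
  · -- `p ≥ 5`, `p ∣ c₄`, `p ∣ z = 1728 Δ`: then `p ∣ Δ`, additive reduction, `p² ∣ N_E`
    intro p hp h5 hpc hpz
    rw [hz] at hpz
    exact hss p hp (by omega) (WeierstrassCurve.sq_dvd_conductorNorm_of_dvd_Δ_of_dvd_c₄ W₀ hΔ0 hmin hp
      (natCast_dvd_of_dvd_mul_of_five_le hp h5 hΔ0 hpz) hpc)

end Summit.ABC.ABC.Theorems.ThinWeightedSzpiro
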